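import Literature.NumberTheory.Transcendental.ShapeLcmValuation
import Literature.NumberTheory.Transcendental.SiegelStepCore
import Literature.NumberTheory.Transcendental.SeedingBlocks
import Literature.NumberTheory.Transcendental.HolonomyBoundTau
import Literature.NumberTheory.LFunctions.LcmUptoCubeBound
import Mathlib.Data.Finset.Fin
import Mathlib.Data.Fin.Tuple.Sort
import Mathlib.Tactic
import HarnessLib

/-!
# The `τ♭` denominator cap (CDT §6.6.2)

Calegari–Dimitrov–Tang, arXiv:2408.15403, §6.6.2 "The `τ♭(𝐛)` piece" (pp. 55–56): for the
minimal exponent `𝐧` of the auxiliary function `F = Σ c_{𝐢,𝐤} 𝐱^𝐤 Π_s f_{i_s}(x_s)` (the `𝐢`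
balanced, i.e. every species `i` occurring `d/m` times), relabelled so that `n_1 ≤ ⋯ ≤ n_d`, the
lowest common denominator of all the `𝐱^𝐧` coefficients of the products
`x^𝐤 g_{π(1)}(x_1)⋯g_{π(d)}(x_d)` with `g` of denominator type `[1,…,b_{i,1}n]⋯[1,…,b_{i,r}n]`
"means nothing more nor less than the lowest common multiple of all products
`Π_i Π_{s ≤ d/m} Π_h [1,…,b_{i,h} · n_{π((i−1)d/m+s)}]`, `π ∈ S_d`" (eq. (6.33)), which is
handled "with a prime-by-prime determination of the maximizing valuation" by Lemma 65 (the
column shape `0 = b_{1,h} = ⋯ = b_{u_h,h} < b_{u_h+1,h} = ⋯ = b_{m,h} = b_h`): all these products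
divide the cap in which species `i` is assigned to the ranks `[(i−1)d/m, i d/m)`, i.e. column `h`
contributes `Π_{j ≥ u_h d/m} [1,…,b_h n_{(j)}]`; "by the prime number theorem, the lowest common
multiple cap evaluates in the `D → ∞` asymptotic to `exp(α τ♭(𝐛) + O(εα) + o(α))`"
(eq. (6.34)).

This file proves, for integer column data `(u_h, b_h)` (the case of the application §13, where
`𝐛 ∈ {0,2}^{14×2}`):

* `flatCap` — the cap `E♭(𝐧) = Π_h Π_{j ≥ u_h q} [1,…,b_h n_{(j)}]` (`q = d/m`, `n_{(j)}` the
  order statistics of `𝐧`);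
* `prod_lcmUpto_dvd_flatCap` — for balanced `𝐢` and any `𝐱 ≤ 𝐧` (e.g. `𝐱 = 𝐧 − 𝐤`),
  `Π_s Π_h [1,…,b_{i_s,h} x_s] ∣ E♭(𝐧)` (Lemma 65 prime by prime, via
  `sum_le_sum_filter_le` of `ShapeLcmValuation`);
* `flatCap_mul_coeff_template_int` — consequently `E♭(𝐧) · β_𝐧 ∈ ℤ` for the `𝐱^𝐧` coefficient
  `β_𝐧` of any template `Σ c_{𝐢,𝐤} 𝐱^𝐤 Π_s f_{i_s}(x_s)` supported on balanced `𝐢`, when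
  `Π_h [1,…,b_{i,h} n] · [x^n] f_i ∈ ℤ` (the case `𝐞 = 0` of the denominator type (6.4));
* `log_flatCap_le` — the size of the cap from an lcm bound `log [1,…,N] ≤ (1+η)N + C` (PNT)
  and pinned order statistics `n_{(j)} ≤ L(j/d + ε)`:
  `log E♭ ≤ (1+η) L (d/2) (Σ_h b_h (1 − (u_h/m)²) + 2ε Σ_h b_h) + r d C`, where
  `Σ_h b_h (1 − u_h²/m²) = τ♭(𝐛)` (`sum_eq_tauFlat`, `HolonomyBound.tauFlat_eq_of_columnShape`);
  with `L ≈ mD` this is `α τ♭ + O(εα) + o(α)`, eq. (6.34).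

No named facts.

## References

* [CalegariDimitrovTang2024] arXiv:2408.15403, §6.6.2 eqs. (6.30)–(6.34), Lemma 65
  (pp. 55–56); Theorem 52 eq. (6.3).
-/

noncomputable section

open Finset PowerSeries

namespace Literature.NumberTheory.Transcendental

namespace CalegariDimitrovTang

variable {d m r : ℕ}

/-! ### Final segments of ranks -/

/-- The final segment of ranks `{j : b ≤ j < d}`. [folklore] -/
def rankGe (d b : ℕ) : Finset (Fin d) := univ.filter fun j => b ≤ (j : ℕ)

/-- `rankGe d b` is `[b, d)` transported to `Fin d`. [folklore] -/
theorem rankGe_eq_attachFin (d b : ℕ) :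
    rankGe d b = (Finset.Ico b d).attachFin (fun _ hj => (Finset.mem_Ico.mp hj).2) := by
  ext j
  simp [rankGe, Finset.mem_attachFin, j.isLt]

/-- `#{j : b ≤ j < d} = d − b`. [folklore] -/
theorem card_rankGe (d b : ℕ) : (rankGe d b).card = d - b := by
  rw [rankGe_eq_attachFin, Finset.card_attachFin, Nat.card_Ico]

/-- Sums over the final segment are sums over `[b, d)`. [folklore] -/
theorem sum_rankGe_eq_sum_Ico (d b : ℕ) (F : ℕ → ℝ) :
    ∑ j ∈ rankGe d b, F j = ∑ j ∈ Finset.Ico b d, F j := by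
  rw [rankGe_eq_attachFin]
  conv_rhs => rw [← Finset.image_val_attachFin (s := Finset.Ico b d) (n := d)
    (fun _ hj => (Finset.mem_Ico.mp hj).2)]
  rw [Finset.sum_image fun x _ y _ hxy => Fin.ext hxy]

/-! ### The cap `E♭(𝐧)` -/

/-- `[1,…,0] = 1`. [folklore] -/
theorem lcmUpto_zero : Nat.lcmUpto 0 = 1 := by
  rw [Nat.lcmUpto, Finset.Icc_eq_empty (by omega), Finset.lcm_empty]

/-- **The `τ♭` cap** `E♭(𝐧) = Π_h Π_{j ≥ u_h q} [1,…,b_h · n_{(j)}]` attached to integer column data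
`(u_h, b_h)`, `q = d/m` and the sorted exponent `n_{(0)} ≤ ⋯ ≤ n_{(d−1)}`.
[cite: CalegariDimitrovTang2024, §6.6.2 eq. (6.33) with Lemma 65 (p. 55)] -/
def flatCap (u c : Fin r → ℕ) (q : ℕ) (ns : Fin d → ℕ) : ℕ :=
  ∏ h, ∏ j ∈ rankGe d (u h * q), Nat.lcmUpto (c h * ns j)

/-- `E♭ > 0`. [folklore] -/
theorem flatCap_pos (u c : Fin r → ℕ) (q : ℕ) (ns : Fin d → ℕ) : 0 < flatCap u c q ns :=
  Finset.prod_pos fun _ _ => Finset.prod_pos fun _ _ => Nat.lcmUpto_pos _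

/-- The number of variables whose species lies in the rows `≥ u` of a balanced assignment is
`(m − u) q`. [folklore] -/
theorem card_filter_species_ge {q : ℕ} {i : Fin d → Fin m}
    (hi : ∀ a, (univ.filter fun s => i s = a).card = q) (u : ℕ) :
    (univ.filter fun s : Fin d => u ≤ ((i s : Fin m) : ℕ)).card = (m - u) * q := by
  rw [Finset.card_eq_sum_card_fiberwise (f := i) (t := rankGe m u) (fun s hs => by
    have hs' : s ∈ univ.filter (fun s : Fin d => u ≤ ((i s : Fin m) : ℕ)) := hs
    have : i s ∈ rankGe m u := Finset.mem_filter.mpr ⟨mem_univ _, (Finset.mem_filter.mp hs').2⟩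
    exact this)]
  have : ∀ a ∈ rankGe m u, ((univ.filter fun s : Fin d => u ≤ ((i s : Fin m) : ℕ)).filter
      fun s => i s = a).card = q := by
    intro a ha
    simp only [rankGe, Finset.mem_filter] at ha
    rw [Finset.filter_filter, ← hi a]
    congr 1
    refine Finset.filter_congr fun s _ => ⟨fun h => h.2, fun h => ⟨by rw [h]; exact ha.2, h⟩⟩
  rw [Finset.sum_congr rfl this, Finset.sum_const, card_rankGe, smul_eq_mul]

/-- **Lemma 65 applied: every product `Π_s Π_h [1,…,b_{i_s,h} x_s]` with balanced species `𝐢`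
and `𝐱 ≤ 𝐧` divides the cap `E♭(𝐧)`.** [cite: CalegariDimitrovTang2024, §6.6.2 eq. (6.33)
and Lemma 65 (pp. 55–56)] -/
theorem prod_lcmUpto_dvd_flatCap {u c : Fin r → ℕ} {q : ℕ} (hd : d = m * q)
    {i : Fin d → Fin m} (hi : ∀ a, (univ.filter fun s => i s = a).card = q)
    (n : Fin d → ℕ) (x : Fin d → ℕ) (hx : ∀ s, x s ≤ n s) :
    ∏ s, ∏ h, Nat.lcmUpto ((if ((i s : Fin m) : ℕ) < u h then 0 else c h) * x s) ∣
      flatCap u c q (n ∘ Tuple.sort n) := by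
  classical
  -- reduce `x` to `n`
  have step1 : ∏ s, ∏ h, Nat.lcmUpto ((if ((i s : Fin m) : ℕ) < u h then 0 else c h) * x s) ∣
      ∏ s, ∏ h, Nat.lcmUpto ((if ((i s : Fin m) : ℕ) < u h then 0 else c h) * n s) :=
    Finset.prod_dvd_prod_of_dvd _ _ fun s _ => Finset.prod_dvd_prod_of_dvd _ _ fun h _ =>
      LFunctions.lcmUpto_dvd_lcmUpto_of_le (Nat.mul_le_mul_left _ (hx s))
  refine step1.trans ?_
  rw [Finset.prod_comm]
  unfold flatCap
  refine Finset.prod_dvd_prod_of_dvd _ _ fun h _ => ?_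
  -- column `h`: the left side is the product over the variables of species `≥ u_h`
  set S : Finset (Fin d) := univ.filter fun s : Fin d => u h ≤ ((i s : Fin m) : ℕ) with hS
  have hL : ∏ s, Nat.lcmUpto ((if ((i s : Fin m) : ℕ) < u h then 0 else c h) * n s) =
      ∏ s ∈ S, Nat.lcmUpto (c h * n s) := by
    rw [hS, Finset.prod_filter]
    refine Finset.prod_congr rfl fun s _ => ?_
    by_cases h1 : ((i s : Fin m) : ℕ) < u h
    · rw [if_pos h1, if_neg (not_le.mpr h1), zero_mul, lcmUpto_zero]
    · rw [if_neg h1, if_pos (not_lt.mp h1)]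
  rw [hL]
  -- compare prime by prime
  have hne1 : ∏ s ∈ S, Nat.lcmUpto (c h * n s) ≠ 0 :=
    Finset.prod_ne_zero_iff.mpr fun s _ => Nat.lcmUpto_ne_zero _
  have hne2 : ∏ j ∈ rankGe d (u h * q), Nat.lcmUpto (c h * (n ∘ Tuple.sort n) j) ≠ 0 :=
    Finset.prod_ne_zero_iff.mpr fun j _ => Nat.lcmUpto_ne_zero _
  rw [← Nat.factorization_le_iff_dvd hne1 hne2, Finsupp.le_def]
  intro p
  rw [Nat.factorization_prod fun s _ => Nat.lcmUpto_ne_zero _,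
    Nat.factorization_prod fun j _ => Nat.lcmUpto_ne_zero _, Finset.sum_apply', Finset.sum_apply']
  by_cases hp : p.Prime
  · simp_rw [Nat.factorization_lcmUpto _ hp]
    -- the monotone summand along the ranks
    set g : Fin d → ℕ := fun j => Nat.log p (c h * n (Tuple.sort n j)) with hg
    have hgmono : Monotone g := fun a b hab =>
      Nat.log_mono_right (Nat.mul_le_mul_left _ (Tuple.monotone_sort n hab))
    -- reindex the left sum by ranks
    have hre : ∑ s ∈ S, Nat.log p (c h * n s) = ∑ j ∈ S.map (Tuple.sort n).symm.toEmbedding, g j := by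
      rw [Finset.sum_map]
      refine Finset.sum_congr rfl fun s _ => ?_
      simp [hg]
    rw [hre]
    change ∑ j ∈ S.map (Tuple.sort n).symm.toEmbedding, g j ≤ ∑ j ∈ rankGe d (u h * q), g j
    refine sum_le_sum_filter_le g hgmono (u h * q) _ ?_
    rw [Finset.card_map, hS, card_filter_species_ge hi]
    change (m - u h) * q = (rankGe d (u h * q)).card
    rw [card_rankGe, hd, ← Nat.sub_mul]
  · simp [Nat.factorization_eq_zero_of_not_prime _ hp]

/-! ### Integrality of `E♭(𝐧) β_𝐧` (the case `𝐞 = 0`) -/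

/-- **`E♭(𝐧) · β_𝐧 ∈ ℤ`**: for series `f_i` of denominator type `Π_h [1,…,b_{i,h} n]`
(integer column-shaped `𝐛`, no integrations) and a template `Σ c_{𝐢,𝐤} 𝐱^𝐤 Π_s f_{i_s}(x_s)`
supported on balanced `𝐢`, the cap clears the denominator of every `𝐱^𝐧` coefficient.
[cite: CalegariDimitrovTang2024, §6.6.2 (pp. 55–56)] -/
theorem flatCap_mul_coeff_template_int (f : Fin m → ℚ⟦X⟧) {u c : Fin r → ℕ}
    (hint : ∀ (i : Fin m) (n : ℕ), ∃ z : ℤ,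
      ((∏ h, Nat.lcmUpto ((if ((i : Fin m) : ℕ) < u h then 0 else c h) * n) : ℕ) : ℚ) *
        PowerSeries.coeff n (f i) = z)
    {q : ℕ} (hd : d = m * q) {D : ℕ} (cc : (Fin d → Fin m) × (Fin d → Fin D) → ℤ)
    (hsupp : ∀ ik, cc ik ≠ 0 → ∀ a, (univ.filter fun s => ik.1 s = a).card = q)
    (n : Fin d →₀ ℕ) :
    ∃ z : ℤ, (flatCap u c q (⇑n ∘ Tuple.sort ⇑n) : ℚ) * MvPowerSeries.coeff n (template f cc) = z := by
  classical
  -- work in the subring of integers of `ℚ`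
  suffices hmem : (flatCap u c q (⇑n ∘ Tuple.sort ⇑n) : ℚ) * MvPowerSeries.coeff n (template f cc) ∈
      (Int.castRingHom ℚ).range by
    obtain ⟨z, hz⟩ := RingHom.mem_range.mp hmem
    exact ⟨z, hz.symm⟩
  unfold template
  rw [map_sum, Finset.mul_sum]
  refine Subring.sum_mem _ fun ik _ => ?_
  rw [map_smul, coeff_tprod, smul_eq_mul, mul_left_comm]
  by_cases hc0 : cc ik = 0
  · simp [hc0]
  refine Subring.mul_mem _ (RingHom.mem_range.mpr ⟨cc ik, by simp⟩) ?_
  -- if some `k_s > n_s` the product vanishes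
  by_cases hk : ∀ s, ((ik.2 s : Fin D) : ℕ) ≤ n s
  · -- `E♭ = M · Π_s Π_h [1,…,b (n_s − k_s)]`
    obtain ⟨M, hM⟩ := prod_lcmUpto_dvd_flatCap (c := c) (u := u) hd (hsupp ik hc0) ⇑n
      (fun s => n s - (ik.2 s : ℕ)) (fun s => Nat.sub_le _ _)
    rw [hM, Nat.cast_mul, mul_comm (_ : ℚ) (M : ℚ), mul_assoc]
    refine Subring.mul_mem _ (RingHom.mem_range.mpr ⟨M, by simp⟩) ?_
    rw [Nat.cast_prod, ← Finset.prod_mul_distrib]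
    refine Subring.prod_mem _ fun s _ => ?_
    rw [PowerSeries.coeff_X_pow_mul', if_pos (hk s)]
    obtain ⟨z, hz⟩ := hint (ik.1 s) (n s - (ik.2 s : ℕ))
    exact RingHom.mem_range.mpr ⟨z, by rw [eq_intCast]; exact hz.symm⟩
  · obtain ⟨s, hs⟩ := not_forall.mp hk
    have hzero : ∏ s, PowerSeries.coeff (n s) ((X : ℚ⟦X⟧) ^ ((ik.2 s : Fin D) : ℕ) * f (ik.1 s)) = 0 :=
      Finset.prod_eq_zero (Finset.mem_univ s) (by rw [PowerSeries.coeff_X_pow_mul', if_neg hs])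
    rw [hzero, mul_zero]
    exact Subring.zero_mem _

/-- Consequently a nonzero `β_𝐧` has `|β_𝐧| ≥ 1/E♭(𝐧)`. [cite: CalegariDimitrovTang2024, §6.7
eq. (6.37) (`log|β| ≥ −α τ + o(α)`)] -/
theorem inv_flatCap_le_abs_coeff (f : Fin m → ℚ⟦X⟧) {u c : Fin r → ℕ}
    (hint : ∀ (i : Fin m) (n : ℕ), ∃ z : ℤ,
      ((∏ h, Nat.lcmUpto ((if ((i : Fin m) : ℕ) < u h then 0 else c h) * n) : ℕ) : ℚ) *
        PowerSeries.coeff n (f i) = z)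
    {q : ℕ} (hd : d = m * q) {D : ℕ} (cc : (Fin d → Fin m) × (Fin d → Fin D) → ℤ)
    (hsupp : ∀ ik, cc ik ≠ 0 → ∀ a, (univ.filter fun s => ik.1 s = a).card = q)
    (n : Fin d →₀ ℕ) (hβ : MvPowerSeries.coeff n (template f cc) ≠ 0) :
    1 / (flatCap u c q (⇑n ∘ Tuple.sort ⇑n) : ℝ) ≤ |((MvPowerSeries.coeff n (template f cc) : ℚ) : ℝ)| := by
  obtain ⟨z, hz⟩ := flatCap_mul_coeff_template_int f hint hd cc hsupp n
  have hE := flatCap_pos u c q (⇑n ∘ Tuple.sort ⇑n)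
  have hEr : (0 : ℝ) < flatCap u c q (⇑n ∘ Tuple.sort ⇑n) := by exact_mod_cast hE
  have hz0 : z ≠ 0 := by
    rintro rfl
    rw [Int.cast_zero, mul_eq_zero] at hz
    rcases hz with h | h
    · exact (Nat.cast_ne_zero.mpr hE.ne') h
    · exact hβ h
  have hz1 : (1 : ℝ) ≤ |(z : ℝ)| := by exact_mod_cast Int.one_le_abs hz0
  have hzr : ((flatCap u c q (⇑n ∘ Tuple.sort ⇑n) : ℚ) : ℝ) *
      ((MvPowerSeries.coeff n (template f cc) : ℚ) : ℝ) = (z : ℝ) := by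
    rw [← Rat.cast_mul, hz]; simp
  rw [div_le_iff₀ hEr]
  calc (1 : ℝ) ≤ |(z : ℝ)| := hz1
    _ = |((MvPowerSeries.coeff n (template f cc) : ℚ) : ℝ)| * flatCap u c q (⇑n ∘ Tuple.sort ⇑n) := by
        rw [← hzr, abs_mul, mul_comm]
        simp

/-! ### The size of the cap (eq. (6.34)) -/

/-- `Σ_{b ≤ j < d} (j/d + ε) ≤ (d/2)(1 − (b/d)²) + dε` (`b ≤ d`). [folklore] -/
theorem sum_Ico_div_add_le {b : ℕ} (hbd : b ≤ d) (hd : 0 < d) (ε : ℝ) (hε : 0 ≤ ε) :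
    ∑ j ∈ Finset.Ico b d, ((j : ℝ) / d + ε) ≤ (d : ℝ) / 2 * (1 - ((b : ℝ) / d) ^ 2) + d * ε := by
  have hdr : (0 : ℝ) < d := by exact_mod_cast hd
  have hbr : (b : ℝ) ≤ d := by exact_mod_cast hbd
  have hb0 : (0 : ℝ) ≤ b := Nat.cast_nonneg _
  have key : ∑ j ∈ Finset.Ico b d, (j : ℝ) ≤ ((d : ℝ) ^ 2 - b ^ 2) / 2 := by
    have hid := SeedData.sum_Ico_succ_mul_two (a := b) (b := d) hbd
    have : ∑ j ∈ Finset.Ico b d, (j : ℝ) = ∑ j ∈ Finset.Ico b d, ((j : ℝ) + 1) - (d - b) := by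
      rw [Finset.sum_add_distrib, Finset.sum_const, Nat.card_Ico, nsmul_eq_mul, mul_one,
        Nat.cast_sub hbd]
      ring
    rw [this]
    nlinarith
  rw [Finset.sum_add_distrib, Finset.sum_const, Nat.card_Ico, nsmul_eq_mul, ← Finset.sum_div,
    Nat.cast_sub hbd]
  have h2 : (∑ j ∈ Finset.Ico b d, (j : ℝ)) / d ≤ ((d : ℝ) ^ 2 - b ^ 2) / 2 / d :=
    div_le_div_of_nonneg_right key hdr.le
  have h3 : ((d : ℝ) ^ 2 - b ^ 2) / 2 / d = d / 2 * (1 - ((b : ℝ) / d) ^ 2) := by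
    field_simp
  have h4 : ((d : ℝ) - b) * ε ≤ d * ε := by nlinarith
  linarith [h2, h3, h4]

/-- **Eq. (6.34): the size of the `τ♭` cap.** If `log [1,…,N] ≤ (1+η)N + C` for all `N` (prime
number theorem) and the order statistics of the exponent satisfy `n_{(j)} ≤ L(j/d + ε)` (Corollary
62 for `𝐧 ∈ L·P_ε^d`), then
`log E♭(𝐧) ≤ (1+η) L ((d/2) Σ_h b_h (1 − (u_h/m)²) + dε Σ_h b_h) + r d C`.
[cite: CalegariDimitrovTang2024, §6.6.2 eq. (6.34) (p. 56)] -/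
theorem log_flatCap_le {u c : Fin r → ℕ} (hu : ∀ h, u h ≤ m) (hm : 0 < m) {q : ℕ} (hq : 0 < q)
    (hd : d = m * q) {η C : ℝ} (hη : 0 ≤ η) (hC : 0 ≤ C)
    (hlcm : ∀ N : ℕ, Real.log (Nat.lcmUpto N) ≤ (1 + η) * N + C)
    (ns : Fin d → ℕ) {L ε : ℝ} (hL : 0 ≤ L) (hε : 0 ≤ ε)
    (hns : ∀ j : Fin d, (ns j : ℝ) ≤ L * ((j : ℕ) / (d : ℝ) + ε)) :
    Real.log (flatCap u c q ns) ≤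
      (1 + η) * L * ((d : ℝ) / 2 * ∑ h, (c h : ℝ) * (1 - ((u h : ℝ) / m) ^ 2) + d * ε * ∑ h, (c h : ℝ)) +
        r * d * C := by
  have hdpos : 0 < d := by rw [hd]; exact Nat.mul_pos hm hq
  have hdr : (0 : ℝ) < d := by exact_mod_cast hdpos
  unfold flatCap
  rw [Nat.cast_prod, Real.log_prod fun h _ => by
    exact_mod_cast (Finset.prod_pos fun j _ => Nat.lcmUpto_pos _).ne']
  -- column by column
  have hcol : ∀ h : Fin r, Real.log ((∏ j ∈ rankGe d (u h * q), Nat.lcmUpto (c h * ns j) : ℕ) : ℝ) ≤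
      (1 + η) * L * ((c h : ℝ) * ((d : ℝ) / 2 * (1 - ((u h : ℝ) / m) ^ 2) + d * ε)) + d * C := by
    intro h
    rw [Nat.cast_prod, Real.log_prod fun j _ => by exact_mod_cast (Nat.lcmUpto_pos _).ne']
    have hb : u h * q ≤ d := by rw [hd]; exact Nat.mul_le_mul_right q (hu h)
    calc ∑ j ∈ rankGe d (u h * q), Real.log (Nat.lcmUpto (c h * ns j) : ℕ)
        ≤ ∑ j ∈ rankGe d (u h * q), ((1 + η) * (c h * (L * ((j : ℕ) / (d : ℝ) + ε))) + C) := by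
          refine Finset.sum_le_sum fun j _ => (hlcm _).trans ?_
          push_cast
          have hc0 : (0 : ℝ) ≤ c h := Nat.cast_nonneg _
          have h1 := mul_le_mul_of_nonneg_left (hns j) hc0
          have h2 := mul_le_mul_of_nonneg_left h1 (by linarith : (0 : ℝ) ≤ 1 + η)
          linarith
      _ = (1 + η) * L * c h * ∑ j ∈ rankGe d (u h * q), (((j : ℕ) : ℝ) / d + ε) +
            (rankGe d (u h * q)).card * C := by
          rw [Finset.sum_add_distrib, Finset.sum_const, nsmul_eq_mul, Finset.mul_sum]
          refine congrArg₂ (· + ·) (Finset.sum_congr rfl fun j _ => by ring) rfl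
      _ ≤ (1 + η) * L * c h * ((d : ℝ) / 2 * (1 - ((u h : ℝ) / m) ^ 2) + d * ε) + d * C := by
          have hS := sum_Ico_div_add_le hb hdpos ε hε
          rw [← sum_rankGe_eq_sum_Ico d (u h * q) (fun j => (j : ℝ) / d + ε)] at hS
          have hcast : ((u h * q : ℕ) : ℝ) / d = (u h : ℝ) / m := by
            rw [hd]; push_cast
            have hqr : (q : ℝ) ≠ 0 := by exact_mod_cast hq.ne'
            have hmr : (m : ℝ) ≠ 0 := by exact_mod_cast hm.ne'
            field_simp
          rw [hcast] at hS
          have hcard : ((rankGe d (u h * q)).card : ℝ) ≤ d := by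
            exact_mod_cast (card_rankGe d _).trans_le (Nat.sub_le _ _)
          have hK : 0 ≤ (1 + η) * L * c h := by positivity
          nlinarith [mul_le_mul_of_nonneg_left hS hK, mul_le_mul_of_nonneg_right hcard hC]
      _ = _ := by ring
  have hXY : ∑ h, (c h : ℝ) * ((d : ℝ) / 2 * (1 - ((u h : ℝ) / m) ^ 2) + d * ε) =
      (d : ℝ) / 2 * ∑ h, (c h : ℝ) * (1 - ((u h : ℝ) / m) ^ 2) + d * ε * ∑ h, (c h : ℝ) := by
    rw [Finset.mul_sum, Finset.mul_sum, ← Finset.sum_add_distrib]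
    exact Finset.sum_congr rfl fun h _ => by ring
  calc ∑ h, Real.log ((∏ j ∈ rankGe d (u h * q), Nat.lcmUpto (c h * ns j) : ℕ) : ℝ)
      ≤ ∑ h, ((1 + η) * L * ((c h : ℝ) * ((d : ℝ) / 2 * (1 - ((u h : ℝ) / m) ^ 2) + d * ε)) + d * C) :=
        Finset.sum_le_sum fun h _ => hcol h
    _ = (1 + η) * L * ∑ h, (c h : ℝ) * ((d : ℝ) / 2 * (1 - ((u h : ℝ) / m) ^ 2) + d * ε) + r * d * C := by
        rw [Finset.sum_add_distrib, Finset.sum_const, card_univ, Fintype.card_fin, nsmul_eq_mul,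
          ← Finset.mul_sum]
        ring
    _ = _ := by rw [hXY]

/-- The main term is `τ♭`: `Σ_h b_h (1 − (u_h/m)²) = τ♭(𝐛)` for the column-shaped array
`b_{i,h} = [i ≥ u_h] b_h`. [cite: CalegariDimitrovTang2024, Theorem 52 eq. (6.3)] -/
theorem sum_eq_tauFlat (hm : 0 < m) {u c : Fin r → ℕ} (hu : ∀ h, u h ≤ m) :
    ∑ h, (c h : ℝ) * (1 - ((u h : ℝ) / m) ^ 2) =
      HolonomyBound.tauFlat (fun (i : Fin m) (h : Fin r) => (((if (i : ℕ) < u h then 0 else c h : ℕ)) : ℝ)) := by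
  rw [HolonomyBound.tauFlat_eq_of_columnShape hm _ u (fun h => (c h : ℝ)) hu (fun i h => by
    split_ifs <;> simp), Finset.mul_sum, ← Finset.sum_sub_distrib]
  have hmr : (m : ℝ) ≠ 0 := by exact_mod_cast hm.ne'
  refine Finset.sum_congr rfl fun h _ => ?_
  field_simp

end CalegariDimitrovTang

end Literature.NumberTheory.Transcendental
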